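import Mathlib
import HarnessLib
import Literature.Probability.MarkovChains.SpectralProfileComparison
import Literature.Probability.MarkovChains.BottleneckRatioSpectralGap
import Literature.Probability.MarkovChains.NashInequality
import Literature.Probability.MarkovChains.CovarianceDecay
import Literature.Probability.MarkovChains.PathComparison
import Literature.Probability.MarkovChains.MetropolizedGibbs

/-!
# First examples for the spectral profile: `λ(S) = min_i λ(S_i)` over components (Lemma 4.1) and the complete graph — `𝓔(f,f) = Var_π(f)`, `λ(S) = 1`, `λ₀(S) = 1 − π(S)`, `λ₁ = 1`, `Λ(r) ≡ 1` (Goel–Montenegro–Tetali 2006, §4, §4.1.1)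

HONEST FRAMING: exact (Metropolis-corrected) sampling algorithms for lattice gauge theory; figures
of merit are autocorrelation/cost numbers at stated couplings and volumes; no continuum-physics claim.

Source (READ on the hub's materialised text, §4 and §4.1.1 "The Complete Graph", p. 9): S. Goel,
R. Montenegro, P. Tetali, *Mixing time bounds via the spectral profile*, Electron. J. Probab. **11**
(2006) 1–26 = math.PR/0505690 [GoelMontenegroTetali2006]: **LEMMA 4.1** "Let `S = S_1 ∪ … ∪ S_k` be a
decomposition of `S` into connected components. Then `λ(S) = min_{S_i}{λ(S_i)}`" with its proof
("Clearly `λ(S) ≤ min` … For a function `f ≥ 0`, define `f_{S_i} = 1_{S_i}f`. Then `Var(f) = … ≤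
Σ Var(f_{S_i})`. Consequently `λ(S) = inf Σ_{S_i}𝓔(f_{S_i},f_{S_i})/Var(f) ≥ inf Σ λ(S_i)Var(f_{S_i})/
Var(f)`"), typed for any decomposition into non-empty parts with no edge between different parts; and
§4.1.1: "Consider the continuous-time walk on the complete
graph in the `n`-point space `Ω = {x_1, …, x_n}` with kernel `K(x_i, x_j) = 1/n ∀ i,j` … the smallest
eigenvalue of `I − K_S` satisfies `λ₀(S) = 1 − |S|/n`, and the second smallest eigenvalue of `I − K`
satisfies `λ₁ = 1`.  Since `λ₁ ≤ λ(S) ≤ λ₀(S)/(1 − π(S))`, `λ(S) = 1` and accordingly `Λ(r) ≡ 1`."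
Everything below is PROVED (finite sums; 0 named facts).

GENERALITY (free): the statements are typed for the kernel **`K(x,y) = π(y)`** (one step samples
from `π`; the tree's `limitMatrix π` of `PeskunOrdering.lean`) with ANY positive probability vector `π`,
for which `𝓔(f,f) = Var_π(f)` (the tree's `dirichletForm_limitMatrix`, LPW Remark 13.9); the printed
walk is the case `π ≡ 1/n`, where `π(S) = |S|/n`.  VOCABULARY (the tree's): `λ(S) =
dirichletEigenvalue`, `λ₀(S) = dirichletEigenvalue₀`, `Λ = spectralProfile` (`SpectralProfile.lean`),
`λ₁ = spectralGapR`, `𝓔 = dirichletForm`, `Var = lawVariance`, `‖·‖₂² = piInner`.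

## Content
* LEMMA 4.1: `dirichletEigenvalue_anti` (`T ⊆ S ⇒ λ(S) ≤ λ(T)`), `setLocalize` (`f_{S_i} = 1_{S_i}f`),
  `setLocalize_sum_eq`, `dirichletForm_eq_sum_setLocalize` (`𝓔(f) = Σ_i 𝓔(f_{S_i})`),
  `lawVariance_le_sum_setLocalize` (`Var f ≤ Σ Var f_{S_i}`), **`GoelMontenegroTetali2006_lemma_4_1_ge`** and
  **`GoelMontenegroTetali2006_lemma_4_1`** (`λ(⊔S_i) = min_i λ(S_i)` as a `Finset.inf'`);
* (the kernel is the tree's `limitMatrix π`, its Dirichlet form `dirichletForm_limitMatrix`;)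
* **`dirichletEigenvalue_limitMatrix`** (`λ(S) = 1`), **`spectralGapR_limitMatrix`** (`λ₁ = 1`),
  **`spectralProfile_limitMatrix`** (`Λ(r) = 1` for `r ≥ π_*`);
* `piInner_setIndicator_self`, **`dirichletEigenvalue₀_limitMatrix`** (`λ₀(S) = 1 − π(S)`, attained at
  `1_S`; `= 1 − |S|/n` for uniform `π`).

NOT HERE: the explicit law `H_t = e^{−t}δ + (1 − e^{−t})/n` and `τ_∞(ε) = log[(n−1)/ε]`, the bound
`τ_∞(ε) ≤ 2 log(n/ε)` (THEOREM 1.1 with `Λ ≡ 1`), and §4.1.2 (the `n`-cycle).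
-/

namespace Literature.Probability.MarkovChains

open Finset Matrix

variable {X : Type*} [Fintype X] [DecidableEq X] {π : X → ℝ}

/-! ## The kernel `K(x,y) = π(y)` is the tree's `limitMatrix π`

`limitMatrix π` (`PeskunOrdering.lean`: every row is `π`; `limitMatrix_apply`,
`limitMatrix_isRowStochastic`, `limitMatrix_detailedBalance`, `limitMatrix_isIrreducible` in
`MetropolizedGibbs.lean`) and **`dirichletForm_limitMatrix`** (`PathComparison.lean`: `𝓔(f,f) =
Var_π(f)`, LPW Remark 13.9) are REUSED below, not restated; for uniform `π ≡ 1/n` this is the printed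
walk `K(x_i,x_j) = 1/n`. -/

/-! ## `λ(S) = 1`, `λ₁ = 1`, `Λ ≡ 1` -/

section Profile

/-- **`λ(S) = 1`** for every non-empty `S` (`|X| ≥ 2`, `π > 0`): every `f ∈ c₀⁺(S)` has
`𝓔(f,f)/Var(f) = 1`. [cite: GoelMontenegroTetali2006, §4.1.1 ("`λ(S) = 1`")] -/
theorem dirichletEigenvalue_limitMatrix [Nontrivial X] (hπ : ∀ x, 0 < π x) (hπ1 : ∑ x, π x = 1)
    {S : Finset X} (hS : S.Nonempty) : dirichletEigenvalue π (limitMatrix π) S = 1 := by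
  unfold dirichletEigenvalue
  have himg : ((fun f : X → ℝ => dirichletForm π (limitMatrix π) f / lawVariance π f) ''
      {f | (∀ x, x ∉ S → f x = 0) ∧ (∀ x, 0 ≤ f x) ∧ 0 < lawVariance π f}) = {1} := by
    obtain ⟨f₀, hf₀⟩ := exists_mem_c0plus hπ hπ1 hS
    refine Set.eq_singleton_iff_unique_mem.2 ⟨⟨f₀, hf₀, ?_⟩, ?_⟩
    · show dirichletForm π (limitMatrix π) f₀ / lawVariance π f₀ = 1
      rw [dirichletForm_limitMatrix hπ1, div_self hf₀.2.2.ne']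
    · rintro _ ⟨f, ⟨-, -, hV⟩, rfl⟩
      show dirichletForm π (limitMatrix π) f / lawVariance π f = 1
      rw [dirichletForm_limitMatrix hπ1, div_self hV.ne']
  rw [himg, csInf_singleton]

omit [DecidableEq X] in
/-- **`λ₁ = 1`** ("the second smallest eigenvalue of `I − K` satisfies `λ₁ = 1`"): the variational
spectral gap `inf{𝓔(f,f) : E_π f = 0, ‖f‖₂ = 1}` equals `1` (`|X| ≥ 2`, `π > 0`).
[cite: GoelMontenegroTetali2006, §4.1.1] -/
theorem spectralGapR_limitMatrix [Nontrivial X] (hπ : ∀ x, 0 < π x) (hπ1 : ∑ x, π x = 1) :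
    spectralGapR π (limitMatrix π) = 1 := by
  unfold spectralGapR
  have himg : ((fun f : X → ℝ => dirichletForm π (limitMatrix π) f) ''
      {f : X → ℝ | ∑ x, π x * f x = 0 ∧ piInner π f f = 1}) = {1} := by
    obtain ⟨g₀, hg₀⟩ := exists_meanZero_piInner_eq_one hπ hπ1
    have hval : ∀ f : X → ℝ, (∑ x, π x * f x = 0 ∧ piInner π f f = 1) →
        dirichletForm π (limitMatrix π) f = 1 := by
      rintro f ⟨hf0, hf1⟩
      rw [dirichletForm_limitMatrix hπ1,
        ← piInner_self_eq_lawVariance_of_lawMean_eq_zero (π := π) (g := f) hf0, hf1]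
    refine Set.eq_singleton_iff_unique_mem.2 ⟨⟨g₀, hg₀, hval g₀ hg₀⟩, ?_⟩
    rintro _ ⟨f, hf, rfl⟩
    exact hval f hf
  rw [himg, csInf_singleton]

/-- **`Λ(r) ≡ 1`** on `[π_*, ∞)` (some non-empty `S` has `π(S) ≤ r`).
[cite: GoelMontenegroTetali2006, §4.1.1 ("and accordingly `Λ(r) ≡ 1`")] -/
theorem spectralProfile_limitMatrix [Nontrivial X] (hπ : ∀ x, 0 < π x) (hπ1 : ∑ x, π x = 1)
    {r : ℝ} (hr : ∃ S : Finset X, S.Nonempty ∧ ∑ x ∈ S, π x ≤ r) :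
    spectralProfile π (limitMatrix π) r = 1 := by
  unfold spectralProfile
  have himg : ((fun S : Finset X => dirichletEigenvalue π (limitMatrix π) S) ''
      {S | S.Nonempty ∧ ∑ x ∈ S, π x ≤ r}) = {1} := by
    obtain ⟨S₀, hS₀, hS₀r⟩ := hr
    refine Set.eq_singleton_iff_unique_mem.2 ⟨⟨S₀, ⟨hS₀, hS₀r⟩, ?_⟩, ?_⟩
    · exact dirichletEigenvalue_limitMatrix hπ hπ1 hS₀
    · rintro _ ⟨S, ⟨hS, -⟩, rfl⟩
      exact dirichletEigenvalue_limitMatrix hπ hπ1 hS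
  rw [himg, csInf_singleton]

end Profile

/-! ## `λ₀(S) = 1 − π(S)` -/

section Restricted

/-- `‖1_S‖₂² = π(S)` (and `Var_π(1_S) = π(S)(1 − π(S))` is the tree's `lawVariance_setIndicator`).
[cite: GoelMontenegroTetali2006, §4.1.1 (the eigenfunction of `K_S` is constant on `S`)] -/
theorem piInner_setIndicator_self (π : X → ℝ) (S : Finset X) :
    piInner π (fun x => if x ∈ S then (1:ℝ) else 0) (fun x => if x ∈ S then (1:ℝ) else 0) =
      ∑ x ∈ S, π x := by
  unfold piInner
  rw [← sum_filter_add_sum_filter_not univ (fun x => x ∈ S)]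
  have h1 : ∑ x ∈ univ.filter (fun x => x ∈ S), π x * ((if x ∈ S then (1:ℝ) else 0) *
      (if x ∈ S then (1:ℝ) else 0)) = ∑ x ∈ S, π x := by
    rw [show univ.filter (fun x => x ∈ S) = S from by ext x; simp]
    exact sum_congr rfl fun x hx => by rw [if_pos hx]; ring
  have h2 : ∑ x ∈ univ.filter (fun x => ¬ x ∈ S), π x * ((if x ∈ S then (1:ℝ) else 0) *
      (if x ∈ S then (1:ℝ) else 0)) = 0 :=
    sum_eq_zero fun x hx => by rw [if_neg (mem_filter.1 hx).2]; ring
  rw [h1, h2, add_zero]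

/-- **`λ₀(S) = 1 − π(S)`** for `K(x,y) = π(y)` and non-empty `S` (`π > 0` a probability vector):
`𝓔(f,f)/‖f‖₂² = Var(f)/‖f‖₂² = 1 − (E_π f)²/‖f‖₂² ≥ 1 − π(S)` by Cauchy–Schwarz on the support, with
equality at `f = 1_S` ("the smallest eigenvalue of `I − K_S` satisfies `λ₀(S) = 1 − |S|/n`"; for uniform
`π`, `π(S) = |S|/n`). [cite: GoelMontenegroTetali2006, §4.1.1] -/
theorem dirichletEigenvalue₀_limitMatrix (hπ : ∀ x, 0 < π x) (hπ1 : ∑ x, π x = 1) {S : Finset X}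
    (hS : S.Nonempty) : dirichletEigenvalue₀ π (limitMatrix π) S = 1 - ∑ x ∈ S, π x := by
  have hπ0 : ∀ x, 0 ≤ π x := fun x => (hπ x).le
  have hπS : 0 < ∑ x ∈ S, π x := sum_pos (fun x _ => hπ x) hS
  have hVar := lawVariance_setIndicator hπ1 S (μ := π)
  have hI := piInner_setIndicator_self π S
  unfold dirichletEigenvalue₀
  refine le_antisymm ?_ ?_
  · -- attained at `1_S`
    refine csInf_le ⟨0, by
      rintro _ ⟨g, ⟨-, hg⟩, rfl⟩
      exact div_nonneg (dirichletForm_nonneg hπ0 (fun _ y => hπ0 y) g) hg.le⟩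
      ⟨fun x => if x ∈ S then (1:ℝ) else 0, ⟨fun x hx => if_neg hx, by rw [hI]; exact hπS⟩, ?_⟩
    show dirichletForm π (limitMatrix π) (fun x => if x ∈ S then (1:ℝ) else 0) /
      piInner π (fun x => if x ∈ S then (1:ℝ) else 0) (fun x => if x ∈ S then (1:ℝ) else 0) =
      1 - ∑ x ∈ S, π x
    rw [dirichletForm_limitMatrix hπ1, hVar, hI]
    field_simp
  · -- Cauchy–Schwarz: `(E f)² ≤ (E|f|)² ≤ π(S)‖f‖₂²`
    refine le_csInf ⟨_, ⟨fun x => if x ∈ S then (1:ℝ) else 0, ⟨fun x hx => if_neg hx, by rw [hI]; exact hπS⟩,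
      rfl⟩⟩ ?_
    rintro _ ⟨f, ⟨hsupp, hff⟩, rfl⟩
    rw [le_div_iff₀ hff, dirichletForm_limitMatrix hπ1]
    have h := piInner_self_eq_lawVariance_add_sq hπ1 f
    have hcs := lawMean_abs_sq_le hπ0 hsupp (π := π) (f := f)
    have habs : lawMean π f ^ 2 ≤ lawMean π (fun x => |f x|) ^ 2 := by
      have h1 : |lawMean π f| ≤ lawMean π (fun x => |f x|) := by
        unfold lawMean
        exact (abs_sum_le_sum_abs _ _).trans (le_of_eq (sum_congr rfl fun x _ => by
          rw [abs_mul, abs_of_nonneg (hπ0 x)]))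
      calc lawMean π f ^ 2 = |lawMean π f| ^ 2 := (sq_abs _).symm
        _ ≤ lawMean π (fun x => |f x|) ^ 2 :=
            pow_le_pow_left₀ (abs_nonneg _) h1 2
    nlinarith [h, hcs, habs]

end Restricted

/-! ## LEMMA 4.1: `λ(S) = min_i λ(S_i)` over the connected components of `S` -/

section Components

variable {P : Matrix X X ℝ}

/-- `λ` is ANTITONE in the set: `T ⊆ S ⇒ λ(S) ≤ λ(T)` (`c₀⁺(T) ⊆ c₀⁺(S)`; `T ≠ ∅`, `|X| ≥ 2`) — "Clearly
`λ(S) ≤ min_{S_i} λ(S_i)`". [cite: GoelMontenegroTetali2006, §4 proof of Lemma 4.1] -/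
theorem dirichletEigenvalue_anti [Nontrivial X] (hπ : ∀ x, 0 < π x)
    (hπ1 : ∑ x, π x = 1) (hP0 : ∀ x y, 0 ≤ P x y) {S T : Finset X} (hTS : T ⊆ S) (hT : T.Nonempty) :
    dirichletEigenvalue π P S ≤ dirichletEigenvalue π P T := by
  have hπ0 : ∀ x, 0 ≤ π x := fun x => (hπ x).le
  obtain ⟨f₀, hf₀⟩ := exists_mem_c0plus hπ hπ1 hT
  refine le_csInf ⟨_, ⟨f₀, hf₀, rfl⟩⟩ ?_
  rintro _ ⟨f, ⟨hsupp, hf, hV⟩, rfl⟩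
  rw [le_div_iff₀ hV]
  exact dirichletEigenvalue_mul_lawVariance_le hπ0 hP0 (fun x hx => hsupp x (fun h => hx (hTS h))) hf

/-- The localisation `f_{S_i} = 1_{S_i}f`. [cite: GoelMontenegroTetali2006, §4 proof of Lemma 4.1
("For a function `f ≥ 0`, define `f_{S_i} = 1_{S_i}f`")] -/
def setLocalize (T : Finset X) (f : X → ℝ) : X → ℝ := fun x => if x ∈ T then f x else 0

omit [Fintype X] in
/-- On a disjoint union `S = ⊔_i S_i`, a function supported in `S` is the sum of its localisations,
and so is its square: `f = Σ_i f_{S_i}`, `f² = Σ_i f_{S_i}²` pointwise.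
[cite: GoelMontenegroTetali2006, §4 proof of Lemma 4.1 ("`Var(f) = Var(Σ_{S_i} f_{S_i})`")] -/
theorem setLocalize_sum_eq {ι : Type*} [Fintype ι] [DecidableEq ι] {T : ι → Finset X}
    (hdisj : ∀ i j, i ≠ j → Disjoint (T i) (T j)) {f : X → ℝ}
    (hsupp : ∀ x, x ∉ Finset.univ.biUnion T → f x = 0) (x : X) :
    (∑ i, setLocalize (T i) f x = f x) ∧ (∑ i, setLocalize (T i) f x ^ 2 = f x ^ 2) := by
  unfold setLocalize
  by_cases hx : x ∈ Finset.univ.biUnion T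
  · obtain ⟨i₀, -, hi₀⟩ := mem_biUnion.1 hx
    have huniq : ∀ i, i ≠ i₀ → x ∉ T i := fun i hi h =>
      disjoint_left.1 (hdisj i i₀ hi) h hi₀
    constructor
    · rw [sum_eq_single i₀ (fun i _ hi => by rw [if_neg (huniq i hi)]) (fun h => absurd (mem_univ _) h),
        if_pos hi₀]
    · rw [sum_eq_single i₀ (fun i _ hi => by rw [if_neg (huniq i hi)]; ring)
        (fun h => absurd (mem_univ _) h), if_pos hi₀]
  · have hnot : ∀ i, x ∉ T i := fun i h => hx (mem_biUnion.2 ⟨i, mem_univ _, h⟩)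
    rw [hsupp x hx]
    constructor
    · exact sum_eq_zero fun i _ => if_neg (hnot i)
    · rw [sum_eq_zero fun i _ => by rw [if_neg (hnot i)]; ring]; ring

/-- **`𝓔(f,f) = Σ_i 𝓔(f_{S_i}, f_{S_i})`** for `f` supported in `S = ⊔_i S_i` when no edge of the chain
joins two different parts (`K(x,y) = 0` for `x ∈ S_i`, `y ∈ S_j`, `i ≠ j` — the `S_i` are unions of
connected components of `S`). [cite: GoelMontenegroTetali2006, §4 proof of Lemma 4.1 ("`λ(S) =
inf 𝓔(f,f)/Var(f) = inf Σ_{S_i} 𝓔(f_{S_i}, f_{S_i})/Var(f)`")] -/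
theorem dirichletForm_eq_sum_setLocalize {ι : Type*} [Fintype ι] [DecidableEq ι] {T : ι → Finset X}
    (hdisj : ∀ i j, i ≠ j → Disjoint (T i) (T j))
    (hcut : ∀ i j, i ≠ j → ∀ x ∈ T i, ∀ y ∈ T j, P x y = 0) {f : X → ℝ}
    (hsupp : ∀ x, x ∉ Finset.univ.biUnion T → f x = 0) :
    dirichletForm π P f = ∑ i, dirichletForm π P (setLocalize (T i) f) := by
  -- pointwise: `(f x − f y)² = Σ_i (f_i x − f_i y)²` unless `K(x,y) = 0`
  have key : ∀ x y, P x y ≠ 0 →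
      (f x - f y) ^ 2 = ∑ i, (setLocalize (T i) f x - setLocalize (T i) f y) ^ 2 := by
    intro x y hP
    unfold setLocalize
    by_cases hx : x ∈ Finset.univ.biUnion T
    · obtain ⟨i₀, -, hi₀⟩ := mem_biUnion.1 hx
      have hxuniq : ∀ i, i ≠ i₀ → x ∉ T i := fun i hi h => disjoint_left.1 (hdisj i i₀ hi) h hi₀
      by_cases hy : y ∈ Finset.univ.biUnion T
      · obtain ⟨j₀, -, hj₀⟩ := mem_biUnion.1 hy
        by_cases hij : i₀ = j₀
        · subst hij
          have hyuniq : ∀ i, i ≠ i₀ → y ∉ T i := fun i hi h => disjoint_left.1 (hdisj i i₀ hi) h hj₀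
          rw [sum_eq_single i₀ (fun i _ hi => by rw [if_neg (hxuniq i hi), if_neg (hyuniq i hi)]; ring)
            (fun h => absurd (mem_univ _) h), if_pos hi₀, if_pos hj₀]
        · exact absurd (hcut i₀ j₀ hij x hi₀ y hj₀) hP
      · have hynot : ∀ i, y ∉ T i := fun i h => hy (mem_biUnion.2 ⟨i, mem_univ _, h⟩)
        rw [hsupp y hy, sum_eq_single i₀ (fun i _ hi => by rw [if_neg (hxuniq i hi), if_neg (hynot i)]; ring)
          (fun h => absurd (mem_univ _) h), if_pos hi₀, if_neg (hynot i₀)]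
    · have hxnot : ∀ i, x ∉ T i := fun i h => hx (mem_biUnion.2 ⟨i, mem_univ _, h⟩)
      rw [hsupp x hx]
      by_cases hy : y ∈ Finset.univ.biUnion T
      · obtain ⟨j₀, -, hj₀⟩ := mem_biUnion.1 hy
        have hyuniq : ∀ i, i ≠ j₀ → y ∉ T i := fun i hi h => disjoint_left.1 (hdisj i j₀ hi) h hj₀
        rw [sum_eq_single j₀ (fun i _ hi => by rw [if_neg (hxnot i), if_neg (hyuniq i hi)]; ring)
          (fun h => absurd (mem_univ _) h), if_neg (hxnot j₀), if_pos hj₀]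
      · have hynot : ∀ i, y ∉ T i := fun i h => hy (mem_biUnion.2 ⟨i, mem_univ _, h⟩)
        rw [hsupp y hy, sum_eq_zero fun i _ => by rw [if_neg (hxnot i), if_neg (hynot i)]; ring]; ring
  have key2 : ∀ x y, π x * P x y * (f x - f y) ^ 2 =
      ∑ i, π x * P x y * (setLocalize (T i) f x - setLocalize (T i) f y) ^ 2 := by
    intro x y
    rw [← mul_sum]
    by_cases hP : P x y = 0
    · rw [hP]; simp
    · rw [key x y hP]
  unfold dirichletForm
  rw [← mul_sum]
  congr 1
  calc ∑ x, ∑ y, π x * P x y * (f x - f y) ^ 2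
      = ∑ x, ∑ y, ∑ i, π x * P x y * (setLocalize (T i) f x - setLocalize (T i) f y) ^ 2 :=
        sum_congr rfl fun x _ => sum_congr rfl fun y _ => key2 x y
    _ = ∑ x, ∑ i, ∑ y, π x * P x y * (setLocalize (T i) f x - setLocalize (T i) f y) ^ 2 :=
        sum_congr rfl fun x _ => sum_comm
    _ = ∑ i, ∑ x, ∑ y, π x * P x y * (setLocalize (T i) f x - setLocalize (T i) f y) ^ 2 := sum_comm

/-- `Var(f) ≤ Σ_i Var(f_{S_i})` for `f ≥ 0` supported in `S = ⊔_i S_i` (`Σπ = 1`): "`Var(Σ f_{S_i}) =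
Σ E f_{S_i}² − (Σ E f_{S_i})² ≤ Σ Var(f_{S_i})`" (the means `E f_{S_i}` are non-negative).
[cite: GoelMontenegroTetali2006, §4 proof of Lemma 4.1] -/
theorem lawVariance_le_sum_setLocalize {ι : Type*} [Fintype ι] [DecidableEq ι]
    {T : ι → Finset X} (hπ0 : ∀ x, 0 ≤ π x) (hπ1 : ∑ x, π x = 1)
    (hdisj : ∀ i j, i ≠ j → Disjoint (T i) (T j)) {f : X → ℝ} (hf : ∀ x, 0 ≤ f x)
    (hsupp : ∀ x, x ∉ Finset.univ.biUnion T → f x = 0) :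
    lawVariance π f ≤ ∑ i, lawVariance π (setLocalize (T i) f) := by
  have hvar : ∀ g : X → ℝ, lawVariance π g = piInner π g g - lawMean π g ^ 2 := fun g => by
    rw [piInner_self_eq_lawVariance_add_sq hπ1 g]; ring
  -- `‖f‖₂² = Σ_i ‖f_i‖₂²` and `E f = Σ_i E f_i`
  have hI : piInner π f f = ∑ i, piInner π (setLocalize (T i) f) (setLocalize (T i) f) := by
    unfold piInner
    rw [sum_comm]
    refine sum_congr rfl fun x _ => ?_
    rw [← mul_sum]
    congr 1
    have h := (setLocalize_sum_eq hdisj hsupp x).2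
    simp only [sq] at h
    exact h.symm
  have hM : lawMean π f = ∑ i, lawMean π (setLocalize (T i) f) := by
    unfold lawMean
    rw [sum_comm]
    refine sum_congr rfl fun x _ => ?_
    rw [← mul_sum, (setLocalize_sum_eq hdisj hsupp x).1]
  have hMi : ∀ i, 0 ≤ lawMean π (setLocalize (T i) f) := fun i =>
    sum_nonneg fun x _ => mul_nonneg (hπ0 x) (by unfold setLocalize; split_ifs <;> [exact hf x; exact le_rfl])
  rw [hvar f, hI, hM]
  simp_rw [hvar]
  rw [sum_sub_distrib]
  linarith [Finset.sum_sq_le_sq_sum_of_nonneg (s := univ) (fun i _ => hMi i)]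

/-- **LEMMA 4.1, the non-trivial inequality: `λ(S) ≥ min_i λ(S_i)`** — if `m ≤ λ(S_i)` for every part
of a decomposition `S = ⊔_i S_i` with no edge between different parts (`0 ≤ m`), then `m ≤ λ(S)`
(`|X| ≥ 2`, `π > 0` a probability vector, `K ≥ 0`). [cite: GoelMontenegroTetali2006, §4 Lemma 4.1
and its proof] -/
theorem GoelMontenegroTetali2006_lemma_4_1_ge [Nontrivial X] {ι : Type*} [Fintype ι]
    [DecidableEq ι] (hπ : ∀ x, 0 < π x) (hπ1 : ∑ x, π x = 1) (hP0 : ∀ x y, 0 ≤ P x y)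
    {T : ι → Finset X} (hdisj : ∀ i j, i ≠ j → Disjoint (T i) (T j))
    (hcut : ∀ i j, i ≠ j → ∀ x ∈ T i, ∀ y ∈ T j, P x y = 0)
    (hS : (Finset.univ.biUnion T).Nonempty) {m : ℝ} (hm : 0 ≤ m)
    (hmi : ∀ i, m ≤ dirichletEigenvalue π P (T i)) :
    m ≤ dirichletEigenvalue π P (Finset.univ.biUnion T) := by
  have hπ0 : ∀ x, 0 ≤ π x := fun x => (hπ x).le
  obtain ⟨f₀, hf₀⟩ := exists_mem_c0plus hπ hπ1 hS
  refine le_csInf ⟨_, ⟨f₀, hf₀, rfl⟩⟩ ?_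
  rintro _ ⟨f, ⟨hsupp, hf, hV⟩, rfl⟩
  rw [le_div_iff₀ hV, dirichletForm_eq_sum_setLocalize hdisj hcut hsupp]
  -- `m·Var(f) ≤ m·Σ Var(f_i) ≤ Σ λ(S_i)Var(f_i) ≤ Σ 𝓔(f_i)`
  have hloc_supp : ∀ i x, x ∉ T i → setLocalize (T i) f x = 0 := fun i x hx => if_neg hx
  have hloc_nonneg : ∀ i x, 0 ≤ setLocalize (T i) f x := fun i x => by
    unfold setLocalize; split_ifs <;> [exact hf x; exact le_rfl]
  calc m * lawVariance π f ≤ m * ∑ i, lawVariance π (setLocalize (T i) f) :=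
        mul_le_mul_of_nonneg_left (lawVariance_le_sum_setLocalize hπ0 hπ1 hdisj hf hsupp) hm
    _ = ∑ i, m * lawVariance π (setLocalize (T i) f) := mul_sum _ _ _
    _ ≤ ∑ i, dirichletForm π P (setLocalize (T i) f) := sum_le_sum fun i _ =>
        (mul_le_mul_of_nonneg_right (hmi i) (lawVariance_nonneg hπ0 _)).trans
          (dirichletEigenvalue_mul_lawVariance_le hπ0 hP0 (hloc_supp i) (hloc_nonneg i))

/-- **LEMMA 4.1 (Goel–Montenegro–Tetali 2006): `λ(S) = min_{S_i} λ(S_i)`** for a decomposition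
`S = S_1 ∪ … ∪ S_k` into non-empty parts with no edge of the chain between different parts (the
connected components of `S`, or unions of them); typed with `Finset.inf'` over the index type.
[cite: GoelMontenegroTetali2006, §4 Lemma 4.1] -/
theorem GoelMontenegroTetali2006_lemma_4_1 [Nontrivial X] {ι : Type*} [Fintype ι]
    [DecidableEq ι] [Nonempty ι] (hπ : ∀ x, 0 < π x) (hπ1 : ∑ x, π x = 1) (hP0 : ∀ x y, 0 ≤ P x y)
    {T : ι → Finset X} (hT : ∀ i, (T i).Nonempty) (hdisj : ∀ i j, i ≠ j → Disjoint (T i) (T j))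
    (hcut : ∀ i j, i ≠ j → ∀ x ∈ T i, ∀ y ∈ T j, P x y = 0) :
    dirichletEigenvalue π P (Finset.univ.biUnion T) =
      Finset.univ.inf' univ_nonempty (fun i => dirichletEigenvalue π P (T i)) := by
  have hπ0 : ∀ x, 0 ≤ π x := fun x => (hπ x).le
  obtain ⟨i₀⟩ := (inferInstance : Nonempty ι)
  have hS : (Finset.univ.biUnion T).Nonempty := by
    obtain ⟨x, hx⟩ := hT i₀; exact ⟨x, mem_biUnion.2 ⟨i₀, mem_univ _, hx⟩⟩
  refine le_antisymm ?_ ?_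
  · refine le_inf' _ _ fun i _ => ?_
    exact dirichletEigenvalue_anti hπ hπ1 hP0 (subset_biUnion_of_mem T (mem_univ i)) (hT i)
  · refine GoelMontenegroTetali2006_lemma_4_1_ge hπ hπ1 hP0 hdisj hcut hS
      (le_inf' _ _ fun i _ => dirichletEigenvalue_nonneg hπ0 hP0 (T i)) fun i => inf'_le _ (mem_univ i)

end Components

end Literature.Probability.MarkovChains
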